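import Summits.QuantumAdvantage.QuantumAdvantage.Theorems.SteerDialAffineLemmasA

/-! # SteerDialAffineLemmas — part 2/2 (mechanical split for landing of `SteerDialAffineLemmas`; content verbatim; scopes re-opened with their variables) -/

set_option linter.style.longLine false
set_option linter.dupNamespace false

namespace Summit.QuantumAdvantage.QuantumAdvantage.Theorems.SteerDial
open Finset
open Literature.Computability.QuantumComplexity Literature.Computability.MetaComplexity
open Literature.Computability.QuantumComplexity.RingHLF
open Summit.QuantumAdvantage.AdviceFreeQNC0
open Summit.QuantumAdvantage.QuantumAdvantage.Theses

section Propagate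

/-- CASE B engine (PROVED): a row recurrence with non-zero top coefficient propagates the first `j+1` conditions of
a shift-structured family (`f t (ρ r y) = f (t + r) y`) to ALL indices. -/
theorem propagate_of_rec {α : Type*} (f : ℕ → α → ZMod 3) (ρ : ℕ → α → α)
    (hf : ∀ t r y, f t (ρ r y) = f (t + r) y) (j : ℕ) (lam : ℕ → ZMod 3) (hj : lam j ≠ 0)
    (hrel : ∀ y, ∑ t ∈ Finset.range (j + 1), lam t * f t y = 0) (b : ZMod 3) (y : α)
    (hy : ∀ t ≤ j, f t y = b) : ∀ s, f s y = b := by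
  intro s
  induction s using Nat.strong_induction_on with
  | _ s ih =>
    by_cases hs : s ≤ j
    · exact hy s hs
    · rw [not_le] at hs
      obtain ⟨r, rfl⟩ : ∃ r, s = j + r := ⟨s - j, by omega⟩
      have h0 := hrel y
      have hr := hrel (ρ r y)
      rw [Finset.sum_range_succ] at h0 hr
      have e0 : ∑ t ∈ Finset.range j, lam t * f t y = ∑ t ∈ Finset.range j, lam t * b :=
        Finset.sum_congr rfl fun t ht => by
          rw [hy t (by have := Finset.mem_range.mp ht; omega)]
      have er : ∑ t ∈ Finset.range j, lam t * f t (ρ r y) = ∑ t ∈ Finset.range j, lam t * b :=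
        Finset.sum_congr rfl fun t ht => by
          rw [hf, ih (t + r) (by have := Finset.mem_range.mp ht; omega)]
      rw [e0, hy j le_rfl] at h0
      rw [er, hf] at hr
      have h : lam j * f (j + r) y = lam j * b := by linear_combination hr - h0
      exact mul_left_cancel₀ hj h

variable {n : ℕ}

/-- The affine form `ℓ_c(y) = Σ_i c_i·[y_i]` on the cube. -/
def lform (c : Fin n → ZMod 3) (y : Fin n → Bool) : ZMod 3 := ∑ i, c i * (if y i then 1 else 0)

/-- Coefficient matrix of the rotated copies: `ℓ_c(rot t y) = Σ_i (rotCoef c t i)·[y_i]`. -/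
noncomputable def rotCoef (c : Fin n → ZMod 3) (t : ℕ) (i : Fin n) : ZMod 3 :=
  c ((Equiv.ofBijective (RingSymmetry.shift n t) (RingSymmetry.shift_bijective t)).symm i)

/-- Transport of a linear form under a rotation: `ℓ_c(rot^t y) = ℓ_{rotCoef c t}(y)`. -/
theorem lform_rot_eq (c : Fin n → ZMod 3) (t : ℕ) (y : Fin n → Bool) :
    lform c (rot t y) = ∑ i, rotCoef c t i * (if y i then 1 else 0) := by
  set σ : Fin n ≃ Fin n := Equiv.ofBijective (RingSymmetry.shift n t) (RingSymmetry.shift_bijective t)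
    with hσ_def
  have hσ : ∀ i, σ i = RingSymmetry.shift n t i := fun i => by rw [hσ_def, Equiv.ofBijective_apply]
  unfold lform
  rw [← Equiv.sum_comp σ (fun i => rotCoef c t i * (if y i then (1 : ZMod 3) else 0))]
  refine Finset.sum_congr rfl fun i _ => ?_
  have h1 : rotCoef c t (σ i) = c i := by
    simp only [rotCoef, ← hσ_def, Equiv.symm_apply_apply]
  rw [h1, hσ i, RingSymmetry.rot_apply]

/-- The rotated family is linear in the coefficient rows: a vanishing row combination kills the forms (PROVED). -/
theorem sum_lform_rot_eq_zero {T : ℕ} (c : Fin n → ZMod 3) (lam : Fin T → ZMod 3)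
    (hrow : ∀ i, ∑ t, lam t * rotCoef c t i = 0) (y : Fin n → Bool) :
    ∑ t : Fin T, lam t * lform c (rot t y) = 0 := by
  simp_rw [lform_rot_eq, Finset.mul_sum]
  rw [Finset.sum_comm]
  refine Finset.sum_eq_zero fun i _ => ?_
  calc ∑ t, lam t * (rotCoef c t i * (if y i then (1 : ZMod 3) else 0))
      = (∑ t, lam t * rotCoef c t i) * (if y i then (1 : ZMod 3) else 0) := by
        rw [Finset.sum_mul]
        exact Finset.sum_congr rfl fun t _ => by ring
    _ = 0 := by rw [hrow i, zero_mul]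

/-- CASE B (PROVED): if a non-trivial combination of the first `T` rotated rows of `ℓ_c` vanishes, a cube point
satisfying the first `T` rotated conditions `ℓ_c(rot t y) = b` satisfies them for EVERY rotation. -/
theorem rotSys_all {T : ℕ} (c : Fin n → ZMod 3) (lam : Fin T → ZMod 3) (hlam : lam ≠ 0)
    (hrow : ∀ i, ∑ t, lam t * rotCoef c t i = 0) (b : ZMod 3) (y : Fin n → Bool)
    (hy : ∀ t < T, lform c (rot t y) = b) : ∀ s, lform c (rot s y) = b := by
  classical
  set lam' : ℕ → ZMod 3 := fun t => if h : t < T then lam ⟨t, h⟩ else 0 with hlam'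
  have hne : (univ.filter fun t : Fin T => lam t ≠ 0).Nonempty := by
    by_contra h
    rw [Finset.not_nonempty_iff_eq_empty, Finset.filter_eq_empty_iff] at h
    apply hlam
    funext t
    simpa using h (mem_univ t)
  set tmax : Fin T := (univ.filter fun t : Fin T => lam t ≠ 0).max' hne with htmax
  have htmem : tmax ∈ (univ.filter fun t : Fin T => lam t ≠ 0) := Finset.max'_mem _ hne
  rw [mem_filter] at htmem
  have hjT : tmax.val < T := tmax.is_lt
  have hjne : lam' tmax.val ≠ 0 := by
    simp only [hlam', dif_pos hjT, Fin.eta]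
    exact htmem.2
  have hzero : ∀ t : Fin T, tmax.val < t.val → lam t = 0 := by
    intro t ht
    by_contra h
    have hle : t ≤ tmax := by
      rw [htmax]
      exact Finset.le_max' _ t (by simp [h])
    exact absurd (Fin.le_def.mp hle) (by omega)
  have hrel : ∀ y, ∑ t ∈ Finset.range (tmax.val + 1), lam' t * lform c (rot t y) = 0 := by
    intro y
    have h1 := sum_lform_rot_eq_zero c lam hrow y
    have h2 : ∑ t : Fin T, lam t * lform c (rot t y) =
        ∑ t ∈ Finset.range T, lam' t * lform c (rot t y) := by
      rw [← Fin.sum_univ_eq_sum_range (fun t => lam' t * lform c (rot t y)) T]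
      refine Finset.sum_congr rfl fun t _ => ?_
      simp only [hlam', dif_pos t.is_lt, Fin.eta]
    rw [h2] at h1
    rw [← h1]
    apply Finset.sum_subset (Finset.range_subset.mpr fun x hx =>
      Finset.mem_range.mpr (lt_of_lt_of_le hx (Nat.succ_le_of_lt tmax.is_lt)))
    intro t ht ht'
    have htT := Finset.mem_range.mp ht
    have hlt : tmax.val < t := by rw [Finset.mem_range] at ht'; omega
    simp only [hlam', dif_pos htT, hzero ⟨t, htT⟩ hlt, zero_mul]
  exact propagate_of_rec (fun t y => lform c (rot t y)) (fun r y => rot r y)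
    (fun t r y => by simp only [RingSymmetry.rot_rot]) tmax.val lam' hjne hrel b y
    (fun t ht => hy t (by omega))

/-- CASE B, set form (PROVED): under the row relation the solution set of the first `T` rotated conditions is
invariant under `rot 1` (both directions). -/
theorem rotSys_invariant {T : ℕ} (c : Fin n → ZMod 3) (lam : Fin T → ZMod 3) (hlam : lam ≠ 0)
    (hrow : ∀ i, ∑ t, lam t * rotCoef c t i = 0) (b : ZMod 3) (y : Fin n → Bool) :
    (∀ t < T, lform c (rot t (rot 1 y)) = b) ↔ (∀ t < T, lform c (rot t y) = b) := by
  constructor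
  · intro h t ht
    have hall := rotSys_all c lam hlam hrow b (rot 1 y) h
    have key := hall (t + (n - 1))
    rw [RingSymmetry.rot_rot] at key
    rcases Nat.eq_zero_or_pos n with hn | hn
    · subst hn
      have e : rot t y = rot t (rot 1 y) := congrArg _ (funext fun i => i.elim0)
      rw [e]
      exact h t ht
    · have e : t + (n - 1) + 1 = t + n * 1 := by omega
      rw [e, ← RingSymmetry.rot_rot, RingSymmetry.rot_mul_self] at key
      exact key
  · intro h t ht
    rw [RingSymmetry.rot_rot]
    exact rotSys_all c lam hlam hrow b y h (t + 1)

/-- Indicator algebra (PROVED): `Π (1 − u_i²)` is the indicator of `∀ i, u_i = 0` in `𝔽₃`. -/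
theorem prod_one_sub_sq {ι : Type*} (s : Finset ι) (u : ι → ZMod 3) :
    ∏ i ∈ s, (1 - (u i) ^ 2) = if (∀ i ∈ s, u i = 0) then 1 else 0 := by
  have hfac : ∀ i ∈ s, (1 - (u i) ^ 2 : ZMod 3) = if u i = 0 then 1 else 0 := by
    intro i _
    generalize u i = v
    revert v
    decide
  rw [Finset.prod_congr rfl hfac, Finset.prod_boole]

end Propagate

end Summit.QuantumAdvantage.QuantumAdvantage.Theorems.SteerDial
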